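import Mathlib
import Literature.Analysis.FluidPDE.ParticleTrajectoryFlow
import Literature.Analysis.FluidPDE.ParticleTrajectoryMeasurePreserving
import Summits.NavierStokesRegularity.NavierStokesRegularity.Theorems.PowerGaugeEulerLiouville.Negative.RelaxingEulerFlowEnergy

/-!
# Crux `EulerZoomLiouville.PowerGaugeEulerLiouville` (stmt-NavierStokesRegularity-19832) —
# NO CLASSICAL EULER FLOW FROM COMPACTLY SUPPORTED VORTICITY IS RELAXING

Negative-lane structure record (prover hand leafhand-ns-eulerzoomliouville-8 g0; `--supports` stmt-19832).  Closing the loop of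
`…Negative.RelaxingEulerFlowEnergy` with the Lagrangian facts of the tree (Majda–Bertozzi §1.3/§1.6 ports:
particle-trajectory maps preserve Lebesgue measure, `IsClassicalNSSolutionOn.measurePreserving_evolutionMap`; the
vorticity-transport (Cauchy) formula `ω(X(α,t),t) = ∇_αX(α,t) ω₀(α)`, `IsClassicalNSSolutionOn.curl_evolutionMap`):

* `volume_support_curl_le_of_classical_euler` — VORTEX VOLUME DOES NOT GROW: for a classical Euler flow on a convex time
  set `S ∋ 0` with Cauchy–Lipschitz velocity, `vol(supp curl u(t)) ≤ vol(supp curl u(0))` for every `t ∈ S` (the flow map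
  pulls `supp ω(t)` back into `supp ω₀` and preserves volume);
* `no_relaxing_classicalEuler_of_compactVorticity` — hence a classical Euler flow on `[0,∞) × ℝ³` with Cauchy–Lipschitz
  velocity, COMPACTLY SUPPORTED INITIAL VORTICITY, `L² ∩ L³` slices with `|p||u| ∈ L¹` locally uniformly in time, positive
  energy at one time and finite-enstrophy slices has `∫∫_{(0,∞)×ℝ³}|∇u|²_F = ∞`.  No such flow is in the forward
  refutation door (F) of X_E (`…Negative.ForwardRelaxingClassicalFlow`): a relaxing global solution refuting the crux,
  if it exists, does NOT come from compactly supported smooth vorticity data.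

WHAT THIS IS NOT: not a refutation or proof of the crux, of a stub, or of the route; not a claim about Navier–Stokes.
[cite: MajdaBertozziCUP2002, §1.3 Prop. 1.4, §1.6 Prop. 1.8 — via the tree] -/

noncomputable section
set_option linter.dupNamespace false
namespace Summit.NavierStokesRegularity.NavierStokesRegularity.Theorems.PowerGaugeEulerLiouville.Negative

open MeasureTheory Set Function Filter Topology Metric Literature.Analysis Literature.Analysis.FluidPDE
open scoped NNReal ENNReal

/-- **Vortex volume does not grow along a classical Euler flow.**  `(u,p)` classical Euler on a convex time set `S ∋ 0`
of unique differentiability, velocity with the Cauchy–Lipschitz hypotheses on `S`: for every `t ∈ S`,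
`vol(supp curl u(t)) ≤ vol(supp curl u(0))` (Cauchy formula + measure-preserving particle-trajectory map).
[cite: MajdaBertozziCUP2002, §1.3 Prop. 1.4, §1.6 Prop. 1.8] -/
theorem volume_support_curl_le_of_classical_euler {S : Set ℝ}
    {u : ℝ → EuclideanSpace ℝ (Fin 3) → EuclideanSpace ℝ (Fin 3)} {p : ℝ → EuclideanSpace ℝ (Fin 3) → ℝ}
    (h : IsClassicalEulerSolutionOn S 0 u p) (hS : Convex ℝ S) (h0 : (0 : ℝ) ∈ S) (hU : UniqueDiffOn ℝ S)
    (hL : ODE.IsUniformlyLipschitzOn u S) {t : ℝ} (ht : t ∈ S) :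
    volume (Function.support (curl (u t))) ≤ volume (Function.support (curl (u 0))) := by
  set X : EuclideanSpace ℝ (Fin 3) → EuclideanSpace ℝ (Fin 3) := ODE.evolutionMap u 0 t with hX
  have hmp : MeasurePreserving X volume volume :=
    IsClassicalNSSolutionOn.measurePreserving_evolutionMap h hS h0 hU hL h0 ht
  have hcont : Continuous (curl (u t)) :=
    continuous_curl ((h.contDiff_velocity ht).of_le (by norm_cast))
  have hmeas : MeasurableSet (Function.support (curl (u t))) := by
    have : Function.support (curl (u t)) = curl (u t) ⁻¹' ({0}ᶜ) := by
      ext x; simp [Function.mem_support]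
    rw [this]
    exact (isOpen_compl_singleton.preimage hcont).measurableSet
  calc volume (Function.support (curl (u t)))
      = volume (X ⁻¹' Function.support (curl (u t))) := (hmp.measure_preimage hmeas.nullMeasurableSet).symm
    _ ≤ volume (Function.support (curl (u 0))) := by
        refine measure_mono fun a ha => ?_
        rw [mem_preimage, Function.mem_support, hX,
          IsClassicalNSSolutionOn.curl_evolutionMap h hS h0 hU hL ht a] at ha
        rw [Function.mem_support]
        intro h0a
        exact ha (by rw [h0a, map_zero])

/-- **NO CLASSICAL EULER FLOW FROM COMPACTLY SUPPORTED VORTICITY IS RELAXING.**  Let `(u,p)` be a classical Euler flow on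
`[0,∞) × ℝ³` whose velocity satisfies the Cauchy–Lipschitz hypotheses (`ODE.IsUniformlyLipschitzOn u (Ici 0)`), with
compactly supported initial vorticity `curl u(0)`, slices with `∫|u|², ∫|u|³, ∫|p||u|` bounded locally uniformly on
`(0,∞)`, positive energy at some time `s₀ > 0`, and finite-enstrophy slices.  Then the space–time enstrophy budget
`∫∫_{(0,∞)×ℝ³}|∇u|²_F ≤ M` fails for every `M`. [folklore] -/
theorem no_relaxing_classicalEuler_of_compactVorticity
    {u : ℝ → EuclideanSpace ℝ (Fin 3) → EuclideanSpace ℝ (Fin 3)} {p : ℝ → EuclideanSpace ℝ (Fin 3) → ℝ} {M : ℝ≥0}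
    (h : IsClassicalEulerSolutionOn (Ici (0 : ℝ)) 0 u p) (hL : ODE.IsUniformlyLipschitzOn u (Ici (0 : ℝ)))
    (hcpt : HasCompactSupport (curl (u 0)))
    (hunif : ∀ a b : ℝ, 0 < a → a < b → ∃ M' : ℝ, ∀ τ ∈ Icc a b,
      (Integrable (fun y => ‖u τ y‖ ^ 2) ∧ ∫ y, ‖u τ y‖ ^ 2 ≤ M') ∧
      (Integrable (fun y => ‖u τ y‖ ^ 3) ∧ ∫ y, ‖u τ y‖ ^ 3 ≤ M') ∧
      (Integrable (fun y => |p τ y| * ‖u τ y‖) ∧ ∫ y, |p τ y| * ‖u τ y‖ ≤ M'))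
    {s₀ : ℝ} (hs₀ : 0 < s₀) (hpos : 0 < ∫ y, ‖u s₀ y‖ ^ 2)
    (hωfin : ∀ s : ℝ, 0 < s → ∫⁻ x, ‖curl (u s) x‖ₑ ^ 2 < ⊤)
    (hEns : ∫⁻ z in Ioi (0 : ℝ) ×ˢ (univ : Set (EuclideanSpace ℝ (Fin 3))),
      ENNReal.ofReal (frobeniusNormSq (fderiv ℝ (u z.1) z.2)) ≤ (M : ℝ≥0∞)) : False := by
  set V₀ : ℝ≥0∞ := volume (Function.support (curl (u 0))) with hV₀def
  have hV₀ : V₀ ≠ ⊤ :=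
    ((measure_mono (subset_tsupport (curl (u 0)))).trans_lt hcpt.isCompact.measure_lt_top).ne
  have hvol : ∀ s : ℝ, 0 < s → volume (Function.support (curl (u s))) ≤ V₀ := fun s hs =>
    volume_support_curl_le_of_classical_euler h (convex_Ici 0) self_mem_Ici (uniqueDiffOn_Ici 0) hL
      (mem_Ici.2 hs.le)
  have hsol : IsClassicalEulerSolutionOn (Ioi (0 : ℝ)) 0 u p :=
    h.mono Ioi_subset_Ici_self isOpen_Ioi.uniqueDiffOn
  exact no_thinVorticity_relaxingEulerFlow hsol hunif hs₀ hpos hωfin hV₀ hvol hEns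

end Summit.NavierStokesRegularity.NavierStokesRegularity.Theorems.PowerGaugeEulerLiouville.Negative
end
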